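import Literature.Topology.FourManifolds.CappellShanesonWang
import Literature.Topology.FourManifolds.CappellShanesonProofs
import Literature.Topology.FourManifolds.PuncturedThreeTorusHomology
import Literature.AlgebraicTopology.SingularHomology.MayerVietorisExactness
import Literature.AlgebraicTopology.SingularHomology.ExcisionMayerVietorisProofs
import HarnessLib

/-!
# Cappell–Shaneson spheres are homotopy 4-spheres: the target fact from the three remaining
named facts

Sibling proof file of `CappellShaneson.lean` / `CappellShanesonWang.lean` for the named fact
`Literature.Topology.FourManifolds.nonempty_homotopyEquiv_sphere_four_of_isCappellShanesonSphere` (S. E. Cappell,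
J. L. Shaneson, *Some new four-manifolds*, Ann. of Math. 104 (1976), §2: for `A ∈ SL(3, ℤ)` with
`det(A - 1) = ±1`, surgery on the section circle of the mapping torus of `A` on `T³` is a homotopy
4-sphere). `CappellShanesonWang.lean` proved it from eight named facts
(`…_of_facts'`); since then five of them have been **discharged** in the tree:

* `CappellShaneson.normalClosure_pushOff_eq_top` — `CappellShanesonProofs.lean`
  (`normalClosure_pushOff_eq_top_holds`);
* excision `relativeSingularHomology.isIso_map_of_interior_union_interior` —
  `…SingularHomology.ExcisionTheorem` (`…_holds`);
* Mayer–Vietoris exactness `mayerVietoris.exact₁`, `mayerVietoris.exact₂` —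
  `…SingularHomology.MayerVietorisExactness` (`exact₁_holds`, `exact₂_holds`);
* `isZero_singularHomology_sphere` — `…SingularHomology.ExcisionMayerVietorisProofs`
  (`isZero_singularHomology_sphere_holds`);

and the puncture comparison `isIso_singularHomology_map_puncturedThreeTorusIncl` has been reduced
in `PuncturedThreeTorusHomology.lean` to the orientability of `T³` plus the existence of
fundamental classes (Hatcher Thm. 3.26(a)). This file records the resulting statements:

* `Literature.Topology.FourManifolds.nonempty_homotopyEquiv_sphere_four_of_isCappellShanesonSphere_of_torusFacts`: the
  target fact, in every universe, follows from exactly four named facts —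
  (T1) `Literature.Topology.FourManifolds.singularHomology_threeTorus_linear` (`H₁`, `H₂` of `T³` with the `SL(3, ℤ)`-action,
  Hatcher §3.C Ex. 11 / Ex. 3.16), (O) `Literature.Topology.FourManifolds.isOrientableOver_int_threeTorus` (`T³` is
  `ℤ`-orientable, Lee Ex. 15.18), (F) `Literature.AlgebraicTopology.SingularHomology.existsUnique_isFundamentalClass` for `T³`
  (Hatcher Thm. 3.26(a) / Lemma 3.27(a), general theory of `…FundamentalClass`), and
  (W) `Literature.Topology.FourManifolds.nonempty_homotopyEquiv_sphere_four_iff` at universe `0` (the recognition of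
  homotopy 4-spheres, `spc4.S10`, Freedman–Quinn §10);
* `…_of_torusFacts'`: the same with (O) + (F) replaced by their only consequence used, the
  surjectivity of `H₃(T³; ℤ) → H₃(T³ | 1; ℤ)`.

Everything here is proved; nothing is asserted.

## References

* S. E. Cappell, J. L. Shaneson, *Some new four-manifolds*, Ann. of Math. 104 (1976), 61–72, §2
  [CappellShanesonAnnals1976].
* A. Hatcher, *Algebraic Topology*, CUP 2002, Thm. 2.20, §2.2, Cor. 2.14, §3.3 Thm. 3.26,
  §3.C Ex. 11 [HatcherAT2002].
-/

noncomputable section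

namespace Literature.Topology.FourManifolds

universe u

/-- Local notation: `𝔼 n` is the model Euclidean space `EuclideanSpace ℝ (Fin n)`. -/
local notation "𝔼 " n:arg => EuclideanSpace ℝ (Fin n)

/-- **Cappell–Shaneson spheres are homotopy 4-spheres, from the four remaining named facts**
(every universe): the target fact `nonempty_homotopyEquiv_sphere_four_of_isCappellShanesonSphere`
follows from (T1) the homology of `T³` with its `SL(3, ℤ)`-action
(`singularHomology_threeTorus_linear`), (O) the orientability of `T³`
(`isOrientableOver_int_threeTorus`), (F) the existence of fundamental classes for `T³`
(`existsUnique_isFundamentalClass`, Hatcher Thm. 3.26(a)) and (W) the recognition of homotopy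
4-spheres at universe `0` (`nonempty_homotopyEquiv_sphere_four_iff`); the fundamental-group
input, excision, Mayer–Vietoris exactness, the homology of spheres, the local homology of `T³` and
the injectivity half of Thm. 3.26 are now theorems of the tree (Cappell–Shaneson, Ann. of Math. 104
(1976), §2). [cite: CappellShanesonAnnals1976, §2] -/
theorem nonempty_homotopyEquiv_sphere_four_of_isCappellShanesonSphere_of_torusFacts
    (hT1 : singularHomology_threeTorus_linear)
    (hO : isOrientableOver_int_threeTorus)
    (hF : @Literature.AlgebraicTopology.SingularHomology.existsUnique_isFundamentalClass ℤ _ ThreeTorus _ 3)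
    (hW : nonempty_homotopyEquiv_sphere_four_iff.{0})
    (X : Type u) [TopologicalSpace X] [ChartedSpace (𝔼 4) X] :
    nonempty_homotopyEquiv_sphere_four_of_isCappellShanesonSphere X :=
  nonempty_homotopyEquiv_sphere_four_of_isCappellShanesonSphere_of_facts'
    CappellShaneson.normalClosure_pushOff_eq_top_holds
    (fun S _ => Literature.AlgebraicTopology.SingularHomology.relativeSingularHomology.isIso_map_of_interior_union_interior_holds ℤ ℤ S)
    (fun _ _ U V => Literature.AlgebraicTopology.SingularHomology.mayerVietoris.exact₁_holds ℤ ℤ U V)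
    (fun _ _ U V => Literature.AlgebraicTopology.SingularHomology.mayerVietoris.exact₂_holds ℤ ℤ U V)
    (Literature.AlgebraicTopology.SingularHomology.isZero_singularHomology_sphere_holds ℤ ℤ) hT1
    (isIso_singularHomology_map_puncturedThreeTorusIncl_of_isOrientable hO hF) hW X

/-- The same with the weakest form of the orientation input actually used: surjectivity of
`H₃(T³; ℤ) → H₃(T³ | 1; ℤ)` (Cappell–Shaneson 1976, §2; Hatcher Thm. 3.26(a)).
[cite: CappellShanesonAnnals1976, §2] -/
theorem nonempty_homotopyEquiv_sphere_four_of_isCappellShanesonSphere_of_torusFacts'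
    (hT1 : singularHomology_threeTorus_linear)
    (hT2 : CategoryTheory.Epi (Literature.AlgebraicTopology.SingularHomology.singularHomology.toLocal ℤ ℤ (1 : ThreeTorus) 3))
    (hW : nonempty_homotopyEquiv_sphere_four_iff.{0})
    (X : Type u) [TopologicalSpace X] [ChartedSpace (𝔼 4) X] :
    nonempty_homotopyEquiv_sphere_four_of_isCappellShanesonSphere X :=
  nonempty_homotopyEquiv_sphere_four_of_isCappellShanesonSphere_of_facts'
    CappellShaneson.normalClosure_pushOff_eq_top_holds
    (fun S _ => Literature.AlgebraicTopology.SingularHomology.relativeSingularHomology.isIso_map_of_interior_union_interior_holds ℤ ℤ S)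
    (fun _ _ U V => Literature.AlgebraicTopology.SingularHomology.mayerVietoris.exact₁_holds ℤ ℤ U V)
    (fun _ _ U V => Literature.AlgebraicTopology.SingularHomology.mayerVietoris.exact₂_holds ℤ ℤ U V)
    (Literature.AlgebraicTopology.SingularHomology.isZero_singularHomology_sphere_holds ℤ ℤ) hT1
    (isIso_singularHomology_map_puncturedThreeTorusIncl_of_epi_toLocal hT2) hW X

end Literature.Topology.FourManifolds
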